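import Literature.Analysis.FluidPDE.BoltzmannEquationProofs
import HarnessLib

/-!
# Gaussian-weighted `L^∞` difference estimates for Grad cut-off collision operators

(Topic MathematicalPhysics/KineticTheory; first layer of the proof of the named fact
`Literature.MathematicalPhysics.KineticTheory.ukai_lanford_bound` — local well-posedness of the
hard-sphere Boltzmann equation in Lanford's weighted `L^∞` class, Gallagher–Saint-Raymond–Texier
2013, Part I Ch. 2 §3.1 Thm 1 and Part II Ch. 5 (continuity estimates, Prop. 5.3.1–5.3.2,
Thm 7); Ukai 1974.)

The continuity estimates of GST 2013 Ch. 5 for the collision operator in the weighted sup norms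
`sup_v e^{γ|v|²/2} |g(v)|` lose a weight `(1 + |v|)`: for a Grad cut-off kernel
`0 ≤ B(v, v_*, ω) ≤ K (1 + |v - v_*|)` and velocity densities `p, q` with
`|p|, |q| ≤ N e^{-γ|v|²/2}` and `|p - q| ≤ D e^{-γ|v|²/2}`, `γ ≥ γₘ > 0`,

  `|Q_B(p, p)(v) - Q_B(q, q)(v)| ≤ 4 K |S^{d-1}| J(γₘ) · N D · (1 + |v|) e^{-γ|v|²/2}`,

`J(γₘ) = ∫ (1 + |u|) e^{-γₘ|u|²/2} du` (`collisionOpWith_lipschitz_gaussian`). The mechanism is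
the one of `Literature.Analysis.FluidPDE.exists_abs_collisionOpWith_le` (conservation of energy
makes the Gaussian a collision invariant), made BILINEAR in `(N, D)` and UNIFORM in the weight
`γ ≥ γₘ`, which is what the decaying-weight (`γ(t) = γ₀ - κ t`) arguments of the local Cauchy
theory consume (Ukai's trick; GST 2013 Ch. 5 §5.4 "continuity estimates involve a loss"). The
same bound is proved for the sign-corrected operator
`∫∫ B (|p'| |p_*'| - p |p_*|)` used by positivity-preserving Picard schemes (it coincides with
`Q_B(p, p)` when `p ≥ 0`). No new definitions are introduced: weights and norms are written out
(`∀ w, |p w| ≤ N * exp (-(γ/2) * ‖w‖ ^ 2)`), as in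
`Literature.MathematicalPhysics.KineticTheory.HierarchyContinuityEstimates`.

## Contents

* `abs_mul_sub_mul_le_of_bounds` — the algebra `|ab - a'b'| ≤ |a - a'||b| + |a'||b - b'|` with
  Gaussian-type bounds plugged in.
* `abs_integral_integral_sub_le` — abstract bound for a difference of iterated integrals
  `∫_E ∫_{S^{d-1}}` whose integrands differ by at most `b(w)`: `≤ |S^{d-1}| ∫ b`.
* `integrable_inner_outer` — inner (`dω`) and outer (`dw`) integrability of a measurable
  integrand dominated by an integrable function of `w` alone.
* `collisionOpWith_lipschitz_gaussian` — the displayed estimate, for `Q_B(p,p) - Q_B(q,q)` and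
  for the sign-corrected operator.
* `collisionOpWith_bound_gaussian` — the case `q = 0`: `|Q_B(p,p)(v)| ≤ 4 K |S| J(γₘ) N² ψ_γ(v)`.
* `hardSphereKernel_le_one_mul` — the hard-sphere kernel has Grad constant `K = 1`.

## References

* I. Gallagher, L. Saint-Raymond, B. Texier, *From Newton to Boltzmann: hard spheres and
  short-range potentials*, EMS (2013) = arXiv:1208.5753, Part I Ch. 2 §3.1 (Thm 1), Part II
  Ch. 5 §§5.1–5.3 (functional spaces, continuity estimates).
* S. Ukai, *On the existence of global solutions of mixed problem for non-linear Boltzmann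
  equation*, Proc. Japan Acad. 50 (1974) 179–184.
-/

open MeasureTheory Metric Real Set Filter Topology
open scoped InnerProductSpace ENNReal
open Literature.Analysis.FluidPDE

namespace Literature.MathematicalPhysics.KineticTheory

noncomputable section

/-! ## Algebra of the bilinear difference -/

section Algebra

/-- `|a b - a' b'| ≤ 2 N D x y` as soon as `|a'| ≤ N x`, `|b| ≤ N y`, `|a - a'| ≤ D x` and
`|b - b'| ≤ D y` (write `ab - a'b' = (a - a') b + a' (b - b')`). [folklore] -/
theorem abs_mul_sub_mul_le_of_bounds {a a' b b' N D x y : ℝ} (hx : 0 ≤ x)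
    (hN : 0 ≤ N) (hD : 0 ≤ D) (ha' : |a'| ≤ N * x) (hb : |b| ≤ N * y) (hda : |a - a'| ≤ D * x)
    (hdb : |b - b'| ≤ D * y) : |a * b - a' * b'| ≤ 2 * N * D * (x * y) := by
  have h1 : a * b - a' * b' = (a - a') * b + a' * (b - b') := by ring
  rw [h1]
  calc |(a - a') * b + a' * (b - b')| ≤ |(a - a') * b| + |a' * (b - b')| := abs_add_le _ _
    _ = |a - a'| * |b| + |a'| * |b - b'| := by rw [abs_mul, abs_mul]
    _ ≤ (D * x) * (N * y) + (N * x) * (D * y) :=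
        add_le_add (mul_le_mul hda hb (abs_nonneg _) (mul_nonneg hD hx))
          (mul_le_mul ha' hdb (abs_nonneg _) (mul_nonneg hN hx))
    _ = 2 * N * D * (x * y) := by ring

end Algebra

/-! ## Iterated integrals over `E × S^{d-1}` -/

section Estimates

variable {E : Type*} [NormedAddCommGroup E] [InnerProductSpace ℝ E] [FiniteDimensional ℝ E]
  [MeasurableSpace E] [BorelSpace E] {B : E × E → sphere (0 : E) 1 → ℝ}

/-- **Abstract difference bound for iterated collision-type integrals.** If two integrands on
`E × S^{d-1}` differ pointwise by at most `b(w)` (a function of the velocity variable alone) and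
all the integrals involved converge absolutely, then
`|∫_E ∫_S F - ∫_E ∫_S G| ≤ |S^{d-1}| ∫_E b`. [folklore] -/
theorem abs_integral_integral_sub_le {F G : E → sphere (0 : E) 1 → ℝ} {b : E → ℝ}
    (hFG : ∀ w ω, |F w ω - G w ω| ≤ b w) (hb : Integrable b)
    (hFi : ∀ w, Integrable (F w) sphereMeasure) (hGi : ∀ w, Integrable (G w) sphereMeasure)
    (hFo : Integrable fun w => ∫ ω, F w ω ∂sphereMeasure)
    (hGo : Integrable fun w => ∫ ω, G w ω ∂sphereMeasure) :
    |(∫ w, ∫ ω, F w ω ∂sphereMeasure) - ∫ w, ∫ ω, G w ω ∂sphereMeasure| ≤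
      (sphereMeasure : Measure (sphere (0 : E) 1)).real univ * ∫ w, b w := by
  haveI := isFiniteMeasure_sphereMeasure (E := E)
  set S : ℝ := (sphereMeasure : Measure (sphere (0 : E) 1)).real univ with hS
  rw [← integral_sub hFo hGo]
  have hpt : ∀ w, |(∫ ω, F w ω ∂sphereMeasure) - ∫ ω, G w ω ∂sphereMeasure| ≤ S * b w := by
    intro w
    rw [← integral_sub (hFi w) (hGi w)]
    calc |∫ ω, F w ω - G w ω ∂sphereMeasure| ≤ ∫ ω, |F w ω - G w ω| ∂sphereMeasure := by
          simpa only [Real.norm_eq_abs] using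
            norm_integral_le_integral_norm (μ := sphereMeasure) (fun ω => F w ω - G w ω)
      _ ≤ ∫ _ω, b w ∂sphereMeasure :=
          integral_mono_of_nonneg (Eventually.of_forall fun _ => abs_nonneg _)
            (integrable_const _) (Eventually.of_forall fun ω => hFG w ω)
      _ = S * b w := by rw [integral_const, smul_eq_mul, hS]
  calc |∫ w, ((∫ ω, F w ω ∂sphereMeasure) - ∫ ω, G w ω ∂sphereMeasure)|
      ≤ ∫ w, |(∫ ω, F w ω ∂sphereMeasure) - ∫ ω, G w ω ∂sphereMeasure| := by
        simpa only [Real.norm_eq_abs] using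
          norm_integral_le_integral_norm (μ := volume)
            (fun w => (∫ ω, F w ω ∂sphereMeasure) - ∫ ω, G w ω ∂sphereMeasure)
    _ ≤ ∫ w, S * b w :=
        integral_mono_of_nonneg (Eventually.of_forall fun _ => abs_nonneg _) (hb.const_mul S)
          (Eventually.of_forall hpt)
    _ = S * ∫ w, b w := integral_const_mul _ _

/-- Inner (`dω`, for EVERY `w`) and outer (`dw`) integrability of a jointly measurable integrand on
`E × S^{d-1}` dominated by an integrable function of `w` alone (the sphere measure is finite).
[folklore] -/
theorem integrable_inner_outer {F : E → sphere (0 : E) 1 → ℝ}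
    (hFm : Measurable (Function.uncurry F)) {b : E → ℝ} (hb : Integrable b)
    (hF : ∀ w ω, |F w ω| ≤ b w) :
    (∀ w, Integrable (F w) sphereMeasure) ∧ Integrable fun w => ∫ ω, F w ω ∂sphereMeasure := by
  haveI := isFiniteMeasure_sphereMeasure (E := E)
  set S : ℝ := (sphereMeasure : Measure (sphere (0 : E) 1)).real univ with hS
  have hinner : ∀ w, Integrable (F w) sphereMeasure := fun w =>
    (integrable_const (b w)).mono'
      (hFm.comp measurable_prodMk_left).aestronglyMeasurable
      (Eventually.of_forall fun ω => by rw [Real.norm_eq_abs]; exact hF w ω)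
  refine ⟨hinner, ?_⟩
  have hsm : StronglyMeasurable fun w => ∫ ω, F w ω ∂sphereMeasure :=
    hFm.stronglyMeasurable.integral_prod_right'
      (ν := (sphereMeasure : Measure (sphere (0 : E) 1)))
  refine (hb.const_mul S).mono' hsm.aestronglyMeasurable (Eventually.of_forall fun w => ?_)
  calc ‖∫ ω, F w ω ∂sphereMeasure‖ ≤ ∫ ω, ‖F w ω‖ ∂sphereMeasure :=
        norm_integral_le_integral_norm _
    _ ≤ ∫ _ω, b w ∂sphereMeasure :=
        integral_mono_of_nonneg (Eventually.of_forall fun _ => norm_nonneg _)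
          (integrable_const _)
          (Eventually.of_forall fun ω => by dsimp only; rw [Real.norm_eq_abs]; exact hF w ω)
    _ = S * b w := by rw [integral_const, smul_eq_mul, hS]

/-- For `γₘ ≤ γ` the Gaussian moment `∫ (1 + |u|) e^{-γ|u|²/2} du` is at most the one at `γₘ`.
[folklore] -/
theorem integral_one_add_norm_mul_exp_mono {γm γ : ℝ} (hγm : 0 < γm) (hγ : γm ≤ γ) :
    ∫ u : E, (1 + ‖u‖) * exp (-(γ / 2) * ‖u‖ ^ 2) ≤
      ∫ u : E, (1 + ‖u‖) * exp (-(γm / 2) * ‖u‖ ^ 2) := by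
  refine integral_mono (integrable_one_add_norm_mul_exp (hγm.trans_le hγ))
    (integrable_one_add_norm_mul_exp hγm) fun u => ?_
  dsimp only
  refine mul_le_mul_of_nonneg_left (exp_le_exp.2 ?_) (by positivity)
  nlinarith [sq_nonneg ‖u‖]

/-- The Gaussian moment `∫ (1 + |u|) e^{-γ|u|²/2} du` is nonnegative. [folklore] -/
theorem integral_one_add_norm_mul_exp_nonneg (γ : ℝ) :
    0 ≤ ∫ u : E, (1 + ‖u‖) * exp (-(γ / 2) * ‖u‖ ^ 2) :=
  integral_nonneg fun u => by positivity

/-- **Gaussian-weighted Lipschitz estimate for Grad cut-off collision operators** (the bilinear,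
weight-uniform form of the continuity estimates of GST 2013 Part II Ch. 5, Prop. 5.3.1–5.3.2 /
Part I Ch. 2 §3.1). Let `0 ≤ B ≤ K (1 + |v - v_*|)` be a Grad cut-off kernel, `0 < γₘ ≤ γ`, and
let `p, q` be measurable velocity densities with `|p|, |q| ≤ N e^{-γ|w|²/2}` and
`|p - q| ≤ D e^{-γ|w|²/2}`. Then, with `S = |S^{d-1}|` and `J = ∫ (1 + |u|) e^{-γₘ|u|²/2} du`,
`|Q_B(p,p)(v) - Q_B(q,q)(v)| ≤ 4 K S J · N D · (1 + |v|) e^{-γ|v|²/2}` for every `v`, and the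
same bound holds for the sign-corrected operators `∫∫ B (|p'| |p_*'| - p |p_*|) dω dv_*`.
Proof: conservation of energy `e^{-γ|v'|²/2} e^{-γ|v_*'|²/2} = e^{-γ|v|²/2} e^{-γ|v_*|²/2}`,
`|ab - a'b'| ≤ |a - a'||b| + |a'||b - b'|`, `B ≤ K (1 + |v|)(1 + |v_*|)`, and
`∫ (1 + |w|) e^{-γ|w|²/2} dw ≤ J`. [cite: GST2013, Part II Ch. 5 §5.3 (continuity estimates, Props. 5.3.1–5.3.2)] -/
theorem collisionOpWith_lipschitz_gaussian (hB : IsGradCutoffKernel B) {K : ℝ} (hK0 : 0 ≤ K)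
    (hK : ∀ p ω, B p ω ≤ K * (1 + ‖p.1 - p.2‖)) {γm γ : ℝ} (hγm : 0 < γm) (hγ : γm ≤ γ)
    {p q : E → ℝ} (hpm : Measurable p) (hqm : Measurable q) {N D : ℝ} (hN : 0 ≤ N) (hD : 0 ≤ D)
    (hp : ∀ w, |p w| ≤ N * exp (-(γ / 2) * ‖w‖ ^ 2))
    (hq : ∀ w, |q w| ≤ N * exp (-(γ / 2) * ‖w‖ ^ 2))
    (hpq : ∀ w, |p w - q w| ≤ D * exp (-(γ / 2) * ‖w‖ ^ 2)) (v : E) :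
    |collisionOpWith B p p v - collisionOpWith B q q v| ≤
        4 * K * (sphereMeasure : Measure (sphere (0 : E) 1)).real univ *
          (∫ u : E, (1 + ‖u‖) * exp (-(γm / 2) * ‖u‖ ^ 2)) * N * D *
          ((1 + ‖v‖) * exp (-(γ / 2) * ‖v‖ ^ 2)) ∧
      |(∫ w, ∫ ω, B (v, w) ω *
            (|p (collide ω (v, w)).1| * |p (collide ω (v, w)).2| - p v * |p w|) ∂sphereMeasure) -
          ∫ w, ∫ ω, B (v, w) ω *
            (|q (collide ω (v, w)).1| * |q (collide ω (v, w)).2| - q v * |q w|) ∂sphereMeasure| ≤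
        4 * K * (sphereMeasure : Measure (sphere (0 : E) 1)).real univ *
          (∫ u : E, (1 + ‖u‖) * exp (-(γm / 2) * ‖u‖ ^ 2)) * N * D *
          ((1 + ‖v‖) * exp (-(γ / 2) * ‖v‖ ^ 2)) := by
  haveI := isFiniteMeasure_sphereMeasure (E := E)
  have hγ0 : 0 < γ := hγm.trans_le hγ
  -- notation
  set S : ℝ := (sphereMeasure : Measure (sphere (0 : E) 1)).real univ with hS
  set J : ℝ := ∫ u : E, (1 + ‖u‖) * exp (-(γm / 2) * ‖u‖ ^ 2) with hJ
  set G : E → ℝ := fun u => exp (-(γ / 2) * ‖u‖ ^ 2) with hG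
  set ψ : E → ℝ := fun u => (1 + ‖u‖) * exp (-(γ / 2) * ‖u‖ ^ 2) with hψ
  have hS0 : 0 ≤ S := measureReal_nonneg
  have hJ0 : 0 ≤ J := integral_one_add_norm_mul_exp_nonneg γm
  have hG0 : ∀ u, 0 ≤ G u := fun u => (exp_pos _).le
  have hψ0 : ∀ u, 0 ≤ ψ u := fun u => by positivity
  have hψi : Integrable ψ := integrable_one_add_norm_mul_exp hγ0
  have hJγ : ∫ u, ψ u ≤ J := integral_one_add_norm_mul_exp_mono hγm hγ
  -- the kernel
  have hBvw : ∀ (w : E) (ω : sphere (0 : E) 1),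
      0 ≤ B (v, w) ω ∧ B (v, w) ω ≤ K * ((1 + ‖v‖) * (1 + ‖w‖)) := fun w ω =>
    ⟨hB.nonneg _ _, (hK (v, w) ω).trans
      (mul_le_mul_of_nonneg_left (one_add_norm_sub_le v w) hK0)⟩
  -- conservation of energy
  have hGG : ∀ (w : E) (ω : sphere (0 : E) 1),
      G (collide ω (v, w)).1 * G (collide ω (v, w)).2 = G v * G w := fun w ω =>
    exp_collide_mul_exp_collide γ ω (v, w)
  -- measurability of the section integrands
  have hmB : Measurable fun z : E × sphere (0 : E) 1 => B (v, z.1) z.2 :=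
    hB.measurable.comp ((measurable_const.prodMk measurable_fst).prodMk measurable_snd)
  have hcc : Continuous fun z : E × sphere (0 : E) 1 => collide z.2 (v, z.1) :=
    continuous_collide_uncurry.comp ((continuous_const.prodMk continuous_fst).prodMk continuous_snd)
  have hm1 : Measurable fun z : E × sphere (0 : E) 1 => (collide z.2 (v, z.1)).1 :=
    hcc.fst.measurable
  have hm2 : Measurable fun z : E × sphere (0 : E) 1 => (collide z.2 (v, z.1)).2 :=
    hcc.snd.measurable
  -- the abstract step, shared by the two operators
  have main : ∀ F₁ F₂ : E → sphere (0 : E) 1 → ℝ,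
      Measurable (Function.uncurry F₁) → Measurable (Function.uncurry F₂) →
      (∀ w ω, |F₁ w ω| ≤ 2 * K * N ^ 2 * (ψ v * ψ w)) →
      (∀ w ω, |F₂ w ω| ≤ 2 * K * N ^ 2 * (ψ v * ψ w)) →
      (∀ w ω, |F₁ w ω - F₂ w ω| ≤ 4 * K * N * D * (ψ v * ψ w)) →
      |(∫ w, ∫ ω, F₁ w ω ∂sphereMeasure) - ∫ w, ∫ ω, F₂ w ω ∂sphereMeasure| ≤
        4 * K * S * J * N * D * ψ v := by
    intro F₁ F₂ hF₁m hF₂m hF₁ hF₂ hF₁₂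
    have hb₁ : Integrable fun w => 2 * K * N ^ 2 * (ψ v * ψ w) :=
      ((hψi.const_mul (ψ v)).const_mul (2 * K * N ^ 2)).congr
        (Eventually.of_forall fun w => by ring)
    have hb : Integrable fun w => 4 * K * N * D * (ψ v * ψ w) :=
      ((hψi.const_mul (ψ v)).const_mul (4 * K * N * D)).congr
        (Eventually.of_forall fun w => by ring)
    obtain ⟨hi₁, ho₁⟩ := integrable_inner_outer hF₁m hb₁ hF₁
    obtain ⟨hi₂, ho₂⟩ := integrable_inner_outer hF₂m hb₁ hF₂
    have h := abs_integral_integral_sub_le hF₁₂ hb hi₁ hi₂ ho₁ ho₂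
    refine h.trans ?_
    have hint : ∫ w, 4 * K * N * D * (ψ v * ψ w) = 4 * K * N * D * ψ v * ∫ w, ψ w := by
      rw [← integral_const_mul]
      exact integral_congr_ae (Eventually.of_forall fun w => by ring)
    rw [hint]
    have h4 : 0 ≤ 4 * K * N * D * ψ v := by
      have := hψ0 v
      positivity
    calc S * (4 * K * N * D * ψ v * ∫ w, ψ w) ≤ S * (4 * K * N * D * ψ v * J) := by
          gcongr
      _ = 4 * K * S * J * N * D * ψ v := by ring
  -- pointwise bounds on the velocity densities
  have hq' : ∀ w, |q w| ≤ N * G w := hq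
  have hp' : ∀ w, |p w| ≤ N * G w := hp
  have habs_p : ∀ w, |(|p w|)| ≤ N * G w := fun w => by rw [abs_abs]; exact hp w
  have habs_q : ∀ w, |(|q w|)| ≤ N * G w := fun w => by rw [abs_abs]; exact hq w
  have habs_pq : ∀ w, |(|p w|) - (|q w|)| ≤ D * G w := fun w =>
    (abs_abs_sub_abs_le_abs_sub _ _).trans (hpq w)
  -- generic product bounds: single products and differences of products
  have hprod : ∀ {a b : ℝ} {x y : E}, |a| ≤ N * G x → |b| ≤ N * G y →
      |a * b| ≤ N ^ 2 * (G x * G y) := by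
    intro a b x y ha hb
    rw [abs_mul]
    calc |a| * |b| ≤ (N * G x) * (N * G y) :=
          mul_le_mul ha hb (abs_nonneg _) (mul_nonneg hN (hG0 x))
      _ = N ^ 2 * (G x * G y) := by ring
  have hdiff : ∀ {a a' b b' : ℝ} {x y : E}, |a'| ≤ N * G x → |b| ≤ N * G y →
      |a - a'| ≤ D * G x → |b - b'| ≤ D * G y →
      |a * b - a' * b'| ≤ 2 * N * D * (G x * G y) := by
    intro a a' b b' x y ha' hb hda hdb
    exact abs_mul_sub_mul_le_of_bounds (hG0 x) hN hD ha' hb hda hdb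
  -- from a bound `c (G v' G w' or G v G w)` on the bracket to a bound on `B · bracket`
  have hkernel : ∀ {c : ℝ} (w : E) (ω : sphere (0 : E) 1) {r : ℝ}, 0 ≤ c →
      |r| ≤ c * (G v * G w) → |B (v, w) ω * r| ≤ K * c * (ψ v * ψ w) := by
    intro c w ω r hc hr
    rw [abs_mul, abs_of_nonneg (hBvw w ω).1]
    calc B (v, w) ω * |r| ≤ (K * ((1 + ‖v‖) * (1 + ‖w‖))) * (c * (G v * G w)) :=
          mul_le_mul (hBvw w ω).2 hr (abs_nonneg _) (by positivity)
      _ = K * c * (ψ v * ψ w) := by simp only [hψ, hG]; ring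
  constructor
  · -- the collision operators themselves
    have h := main
      (fun w ω => B (v, w) ω * (p (collide ω (v, w)).1 * p (collide ω (v, w)).2 - p v * p w))
      (fun w ω => B (v, w) ω * (q (collide ω (v, w)).1 * q (collide ω (v, w)).2 - q v * q w))
      (hmB.mul (((hpm.comp hm1).mul (hpm.comp hm2)).sub
        ((measurable_const.mul (hpm.comp measurable_fst)))))
      (hmB.mul (((hqm.comp hm1).mul (hqm.comp hm2)).sub
        ((measurable_const.mul (hqm.comp measurable_fst)))))
      (fun w ω => by
        have h1 := hprod (hp' (collide ω (v, w)).1) (hp' (collide ω (v, w)).2)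
        have h2 := hprod (hp' v) (hp' w)
        rw [hGG w ω] at h1
        rw [mul_sub]
        refine (abs_sub _ _).trans ?_
        have e1 := hkernel w ω (by positivity) h1
        have e2 := hkernel w ω (by positivity) h2
        linarith)
      (fun w ω => by
        have h1 := hprod (hq' (collide ω (v, w)).1) (hq' (collide ω (v, w)).2)
        have h2 := hprod (hq' v) (hq' w)
        rw [hGG w ω] at h1
        rw [mul_sub]
        refine (abs_sub _ _).trans ?_
        have e1 := hkernel w ω (by positivity) h1
        have e2 := hkernel w ω (by positivity) h2
        linarith)
      (fun w ω => by
        have h1 := hdiff (hq' (collide ω (v, w)).1) (hp' (collide ω (v, w)).2)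
          (hpq (collide ω (v, w)).1) (hpq (collide ω (v, w)).2)
        have h2 := hdiff (hq' v) (hp' w) (hpq v) (hpq w)
        rw [hGG w ω] at h1
        have e : B (v, w) ω * (p (collide ω (v, w)).1 * p (collide ω (v, w)).2 - p v * p w) -
            B (v, w) ω * (q (collide ω (v, w)).1 * q (collide ω (v, w)).2 - q v * q w) =
          B (v, w) ω * (p (collide ω (v, w)).1 * p (collide ω (v, w)).2 -
              q (collide ω (v, w)).1 * q (collide ω (v, w)).2) -
            B (v, w) ω * (p v * p w - q v * q w) := by ring
        rw [e]
        refine (abs_sub _ _).trans ?_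
        have e1 := hkernel w ω (by positivity) h1
        have e2 := hkernel w ω (by positivity) h2
        linarith)
    simpa only [collisionOpWith] using h
  · -- the sign-corrected operators
    have habsm : Measurable fun x : ℝ => |x| := continuous_abs.measurable
    exact main
      (fun w ω => B (v, w) ω *
        (|p (collide ω (v, w)).1| * |p (collide ω (v, w)).2| - p v * |p w|))
      (fun w ω => B (v, w) ω *
        (|q (collide ω (v, w)).1| * |q (collide ω (v, w)).2| - q v * |q w|))
      (hmB.mul ((((habsm.comp (hpm.comp hm1))).mul (habsm.comp (hpm.comp hm2))).sub
        ((measurable_const.mul (habsm.comp (hpm.comp measurable_fst))))))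
      (hmB.mul ((((habsm.comp (hqm.comp hm1))).mul (habsm.comp (hqm.comp hm2))).sub
        ((measurable_const.mul (habsm.comp (hqm.comp measurable_fst))))))
      (fun w ω => by
        have h1 := hprod (habs_p (collide ω (v, w)).1) (habs_p (collide ω (v, w)).2)
        have h2 := hprod (hp' v) (habs_p w)
        rw [hGG w ω] at h1
        rw [mul_sub]
        refine (abs_sub _ _).trans ?_
        have e1 := hkernel w ω (by positivity) h1
        have e2 := hkernel w ω (by positivity) h2
        linarith)
      (fun w ω => by
        have h1 := hprod (habs_q (collide ω (v, w)).1) (habs_q (collide ω (v, w)).2)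
        have h2 := hprod (hq' v) (habs_q w)
        rw [hGG w ω] at h1
        rw [mul_sub]
        refine (abs_sub _ _).trans ?_
        have e1 := hkernel w ω (by positivity) h1
        have e2 := hkernel w ω (by positivity) h2
        linarith)
      (fun w ω => by
        have h1 := hdiff (habs_q (collide ω (v, w)).1) (habs_p (collide ω (v, w)).2)
          (habs_pq (collide ω (v, w)).1) (habs_pq (collide ω (v, w)).2)
        have h2 := hdiff (hq' v) (habs_p w) (hpq v) (habs_pq w)
        rw [hGG w ω] at h1
        have e : B (v, w) ω *
              (|p (collide ω (v, w)).1| * |p (collide ω (v, w)).2| - p v * |p w|) -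
            B (v, w) ω *
              (|q (collide ω (v, w)).1| * |q (collide ω (v, w)).2| - q v * |q w|) =
          B (v, w) ω * (|p (collide ω (v, w)).1| * |p (collide ω (v, w)).2| -
              |q (collide ω (v, w)).1| * |q (collide ω (v, w)).2|) -
            B (v, w) ω * (p v * |p w| - q v * |q w|) := by ring
        rw [e]
        refine (abs_sub _ _).trans ?_
        have e1 := hkernel w ω (by positivity) h1
        have e2 := hkernel w ω (by positivity) h2
        linarith)

/-- **Gaussian-weighted bound for Grad cut-off collision operators** (GST 2013 Part II Ch. 5,
continuity estimate for one collision operator; the case `q = 0` of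
`collisionOpWith_lipschitz_gaussian`): for `|p| ≤ N e^{-γ|w|²/2}`, `0 < γₘ ≤ γ`,
`|Q_B(p,p)(v)| ≤ 4 K |S^{d-1}| J(γₘ) N² (1 + |v|) e^{-γ|v|²/2}`, and the same for the
sign-corrected operator. [cite: GST2013, Part II Ch. 5 §5.3 (continuity estimates, Props. 5.3.1–5.3.2)] -/
theorem collisionOpWith_bound_gaussian (hB : IsGradCutoffKernel B) {K : ℝ} (hK0 : 0 ≤ K)
    (hK : ∀ p ω, B p ω ≤ K * (1 + ‖p.1 - p.2‖)) {γm γ : ℝ} (hγm : 0 < γm) (hγ : γm ≤ γ)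
    {p : E → ℝ} (hpm : Measurable p) {N : ℝ} (hN : 0 ≤ N)
    (hp : ∀ w, |p w| ≤ N * exp (-(γ / 2) * ‖w‖ ^ 2)) (v : E) :
    |collisionOpWith B p p v| ≤
        4 * K * (sphereMeasure : Measure (sphere (0 : E) 1)).real univ *
          (∫ u : E, (1 + ‖u‖) * exp (-(γm / 2) * ‖u‖ ^ 2)) * N * N *
          ((1 + ‖v‖) * exp (-(γ / 2) * ‖v‖ ^ 2)) ∧
      |∫ w, ∫ ω, B (v, w) ω *
          (|p (collide ω (v, w)).1| * |p (collide ω (v, w)).2| - p v * |p w|) ∂sphereMeasure| ≤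
        4 * K * (sphereMeasure : Measure (sphere (0 : E) 1)).real univ *
          (∫ u : E, (1 + ‖u‖) * exp (-(γm / 2) * ‖u‖ ^ 2)) * N * N *
          ((1 + ‖v‖) * exp (-(γ / 2) * ‖v‖ ^ 2)) := by
  have h0 : ∀ w : E, |(fun _ : E => (0 : ℝ)) w| ≤ N * exp (-(γ / 2) * ‖w‖ ^ 2) := fun w => by
    simp only [abs_zero]; positivity
  have hp0 : ∀ w : E, |p w - (fun _ : E => (0 : ℝ)) w| ≤ N * exp (-(γ / 2) * ‖w‖ ^ 2) := fun w => by
    simp only [sub_zero]; exact hp w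
  have h := collisionOpWith_lipschitz_gaussian hB hK0 hK hγm hγ hpm measurable_const hN hN hp h0
    hp0 v
  have hQ0 : collisionOpWith B (fun _ : E => (0 : ℝ)) (fun _ : E => (0 : ℝ)) v = 0 := by
    simp [collisionOpWith]
  have hI0 : (∫ w, ∫ ω, B (v, w) ω * (|(fun _ : E => (0 : ℝ)) (collide ω (v, w)).1| *
      |(fun _ : E => (0 : ℝ)) (collide ω (v, w)).2| - (fun _ : E => (0 : ℝ)) v *
        |(fun _ : E => (0 : ℝ)) w|) ∂sphereMeasure) = 0 := by
    simp
  rw [hQ0, hI0, sub_zero, sub_zero] at h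
  exact h

omit [FiniteDimensional ℝ E] [MeasurableSpace E] [BorelSpace E] in
/-- The hard-sphere kernel `((v - v_*)·ω)_+` is a Grad cut-off kernel with constant `K = 1`:
`((v - v_*)·ω)_+ ≤ 1 · (1 + |v - v_*|)`. [folklore] -/
theorem hardSphereKernel_le_one_mul (p : E × E) (ω : sphere (0 : E) 1) :
    hardSphereKernel p ω ≤ 1 * (1 + ‖p.1 - p.2‖) := by
  rw [hardSphereKernel, one_mul, max_le_iff]
  refine ⟨?_, by positivity⟩
  calc ⟪p.1 - p.2, (ω : E)⟫_ℝ ≤ ‖p.1 - p.2‖ * ‖(ω : E)‖ := real_inner_le_norm _ _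
    _ = ‖p.1 - p.2‖ := by rw [norm_eq_of_mem_sphere ω, mul_one]
    _ ≤ 1 + ‖p.1 - p.2‖ := by linarith [norm_nonneg (p.1 - p.2)]

end Estimates

end

end Literature.MathematicalPhysics.KineticTheory
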